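import Summits.KontsevichZagierPeriods.Zeta5Search.Brown8.XStarOrbitCoverC

/-!
# Brown8 / XStarOrbitCover — the symmetry cover of BZ's live cone: statements and the conditional capstone

systematic search; no irrationality claim unless certified.

This file set PROVES the two `@[conjecture]`-tagged nodes of
`Summits/KontsevichZagierPeriods/Zeta5Search/Families/CellularEightMiddleWeights.lean`
(fam-brown8 gen 3, census/mw; status there: THEOREM-BY-COMPUTATION resp. OBSERVED):

* `xStarOrbitCover_holds : XStarOrbitCover` — every live convergent integer exponent vector `a` of BZ's
  8-term cellular family (`BrownZudilin2022.Converges a ∧ LiveBZ a`) is carried by a word `w` in the five typed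
  generators `i₁, p₀₁, p₁₂, h, h'` (`applyGen 0…4`), with EVERY intermediate vector convergent
  (`ConvergentChain w a`), to a vector inside the `X*`-region (`PolarWithinXStar (applyWord w a)`);
* `xStarOrbitCoverG_holds : XStarOrbitCoverG` — the group-element form (from the chain form by the tree's
  `xStarOrbitCoverG_of_chain`);
* `liveBZ_zeta3Free_of` — the typed CAPSTONE of the census/mw argument, CONDITIONAL on its two analytic inputs taken as
  hypotheses: BZ's invariance (27) per generator on common convergence domains (`BrownZudilin2022.invariance_of_converges'`,
  a named Literature fact) and the ζ(3)-free law on the `X*`-region (`BZXStarZeta3Free`, conjecture-tagged node resting on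
  [Brown2016, Cor. 8.2] + the computed `gr^W_6 = 0`) ⟹ for EVERY live convergent `a`,
  `I(a) ∈ ℚ·(2ζ(5)+4ζ(3)ζ(2)) + ℚ·ζ(2) + ℚ` ('ζ(3) drops out' on the whole live cone without BZ's explicit decomposition (4)).

Net effect on the tree: two conjecture-tagged nodes become theorems (the `@[conjecture]` attribute on the two `def`s is
now historical; the defs are unchanged).  What this does NOT say: nothing about irrationality; `BZXStarZeta3Free` itself is
NOT proved here (it stays conjecture-tagged); the cover is the combinatorial half of the census/mw argument, and the capstone
only makes the dependence on the two analytic inputs explicit and kernel-checked.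

## Proof structure (generated, then kernel-checked; the generator is not trusted)

An exact polyhedral cover found by a depth-first containment/splitting search over the Chvátal–Gomory-primitive rows
of the typed statement (17 convergence forms `≥ 0`, 20 `σ_F` rows `≤ -1`; targets: the convergence rows of every
prefix image and the 14 outside-`X*` rows of the final image), re-implemented statically from the tree text
(fam-brown8 g10, `pub-zeta5-fam-brown8/g10/{forms,xlp,group,cover,gen_lean}.py`; exact rational simplex / Farkas
alternatives; 64 nodes = 39 certified pieces + 24 case splits + 1 empty piece; 19 words of
length ≤ 4; search time < 30 s).  Each piece is ONE theorem `XStarCover.node_<k>` whose hypotheses are `Converges a`,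
`LiveBZ a` and the case literals of its branch (hypotheses a proof does not use carry a leading `_`); a certified piece names
its word and is closed by `omega` after unfolding; a split piece is a `by_cases` cascade over the (at most three) target rows
that can fail on it, handing each failing case to a child piece.  `omega` re-derives every containment inside the kernel, so
the Python search is evidence of nothing — only of where to look.  The pieces are spread over the files
`Brown8/XStarOrbitCoverA.lean`, `…B.lean`, … (children before parents, each file importing the previous one); the statements proper
are in `Brown8/XStarOrbitCover.lean`.  Imports: `Families/CellularEightMiddleWeights` (the statements) and
`Families/CellularBrownZudilin` (only for its unfolding lemma `converges_iff`).
-/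

namespace Summit.KontsevichZagierPeriods.Zeta5Search.Families.Cellular

open Literature.NumberTheory.Irrationality
open Literature.NumberTheory.Irrationality.BrownZudilin2022
open Literature.NumberTheory.Transcendental (zetaValue)

namespace XStarCover

/-! ### Chains and BZ's normalisation (27) -/

/-- A convergent chain starts at a convergent vector. -/
theorem converges_of_convergentChain (w : List (Fin 5)) (a : Fin 8 → ℤ) (h : ConvergentChain w a) : Converges a := by
  have := h 0 (by simp)
  simpa [applyWord] using this

/-- A convergent chain ends at a convergent vector. -/
theorem converges_last_of_convergentChain (w : List (Fin 5)) (a : Fin 8 → ℤ) (h : ConvergentChain w a) :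
    Converges (applyWord w a) := by
  have := h w.length (by simp)
  simpa using this

/-- One generator step of (27) on the common domain of convergence, indexed as `applyGen`. -/
theorem normalisedIntegral'_applyGen (h27 : invariance_of_converges') (i : Fin 5) (a : Fin 8 → ℤ)
    (ha : Converges a) (hi : Converges (applyGen i a)) : normalisedIntegral' (applyGen i a) = normalisedIntegral' a := by
  obtain ⟨h0, h1, h2, h3, h4⟩ := h27 a ha
  fin_cases i
  · exact h0 hi
  · exact h1 hi
  · exact h2 hi
  · exact h3 hi
  · exact h4 hi

/-- (27) along a convergent chain: the normalised integral `I(a)/∏_{i∈F} h_i(a)!` is constant. -/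
theorem normalisedIntegral'_chain (h27 : invariance_of_converges') :
    ∀ (w : List (Fin 5)) (a : Fin 8 → ℤ), ConvergentChain w a → normalisedIntegral' (applyWord w a) = normalisedIntegral' a := by
  intro w
  induction w with
  | nil => intro a _; rfl
  | cons i w ih =>
    intro a h
    rw [convergentChain_cons] at h
    obtain ⟨ha, hw⟩ := h
    have hi : Converges (applyGen i a) := converges_of_convergentChain w _ hw
    show normalisedIntegral' (applyWord w (applyGen i a)) = normalisedIntegral' a
    rw [ih _ hw, normalisedIntegral'_applyGen h27 i a ha hi]

/-- The factorial normaliser of (27) is the cast of a natural number … -/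
theorem normaliser_eq_cast (c : Fin 8 → ℤ) :
    (Fset.map fun i => ((hForm c i).toNat.factorial : ℝ)).prod =
      (((Fset.map fun i => (hForm c i).toNat.factorial).prod : ℕ) : ℝ) := by
  rw [Nat.cast_list_prod, List.map_map]; rfl

/-- … which is positive. -/
theorem normaliser_pos (c : Fin 8 → ℤ) : 0 < (Fset.map fun i => (hForm c i).toNat.factorial).prod := by
  apply List.prod_pos
  intro x hx
  rw [List.mem_map] at hx
  obtain ⟨i, _, rfl⟩ := hx
  exact Nat.factorial_pos _

end XStarCover

/-- **The symmetry cover of BZ's live cone, chain form** (discharges the `@[conjecture]` node `XStarOrbitCover` of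
`Families/CellularEightMiddleWeights.lean`): every live convergent integer vector of BZ's 8-term cellular family is carried by a
chain of the typed generators, every link convergent, into the `X*`-region.  systematic search; no irrationality claim unless certified. -/
theorem xStarOrbitCover_holds : XStarOrbitCover := fun a hc hl => XStarCover.node_63 a hc hl

/-- **Group-element form** (discharges the `@[conjecture]` node `XStarOrbitCoverG`). -/
theorem xStarOrbitCoverG_holds : XStarOrbitCoverG := xStarOrbitCoverG_of_chain xStarOrbitCover_holds

/-! ### Conditional corollary: ζ(3) drops out on the whole live cone -/

/-- **ζ(3) drops out on the live cone, conditionally** (typed capstone of the census/mw argument): GIVEN BZ's invariance (27)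
per generator on common convergence domains (`invariance_of_converges'`, named Literature fact, hypothesis) and the ζ(3)-free law
on the `X*`-region (`BZXStarZeta3Free`, conjecture-tagged node: [Brown2016, Cor. 8.2] + computed `gr^W_6 = 0`, hypothesis), the
symmetry cover transports the law along a convergent chain to EVERY live convergent integer vector:
`I(a) ∈ ℚ·(2ζ(5)+4ζ(3)ζ(2)) + ℚ·ζ(2) + ℚ` (the rational rescaling is the ratio of the factorial normalisers of (27)).
No irrationality content.  systematic search; no irrationality claim unless certified. -/
theorem liveBZ_zeta3Free_of (h27 : invariance_of_converges') (hX : BZXStarZeta3Free)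
    (a : Fin 8 → ℤ) (hc : Converges a) (hl : LiveBZ a) :
    ∃ q r s : ℚ, cellularIntegral a = q * (2 * zetaValue 5 + 4 * zetaValue 3 * zetaValue 2) + r * zetaValue 2 + s := by
  obtain ⟨w, hch, hp⟩ := xStarOrbitCover_holds a hc hl
  have hb : Converges (applyWord w a) := XStarCover.converges_last_of_convergentChain w a hch
  obtain ⟨q, r, s, hI⟩ := hX _ hb hp
  have hinv := XStarCover.normalisedIntegral'_chain h27 w a hch
  unfold normalisedIntegral' at hinv
  rw [XStarCover.normaliser_eq_cast, XStarCover.normaliser_eq_cast] at hinv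
  set Na := (Fset.map fun i => (hForm a i).toNat.factorial).prod with hNa
  set Nb := (Fset.map fun i => (hForm (applyWord w a) i).toNat.factorial).prod with hNb
  have hNa0 : (0 : ℝ) < (Na : ℝ) := by exact_mod_cast XStarCover.normaliser_pos a
  have hNb0 : (0 : ℝ) < (Nb : ℝ) := by exact_mod_cast XStarCover.normaliser_pos (applyWord w a)
  have ha' : cellularIntegral a = (Na : ℝ) / (Nb : ℝ) * cellularIntegral (applyWord w a) := by
    rw [div_eq_div_iff hNb0.ne' hNa0.ne'] at hinv
    field_simp
    linarith [hinv]
  refine ⟨(Na : ℚ) / Nb * q, (Na : ℚ) / Nb * r, (Na : ℚ) / Nb * s, ?_⟩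
  rw [ha', hI]
  push_cast
  ring

end Summit.KontsevichZagierPeriods.Zeta5Search.Families.Cellular
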